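import Summits.AtomisticToContinuum.Crystallization.Theorems.PalmUnimodularRigidityShellsToBarlowChartDefs
import Literature.MathematicalPhysics.StatisticalMechanics.BarlowRings

/-!
# Crux `ShellsToBarlowChart` (stmt-AtomisticToContinuum-9227) — negative lemmas, part VI:
# the hypotheses of `stub_powerTranslation` (line `develop-the-model-growth-descent`)

The stub (lead skeleton `Cruxes/ShellsToBarlowChart/Lines/develop_the_model_growth_descent.lean`)
reads: for a Hägg word `s` and a contact automorphism `σ` of the model
`B = barlowStacking 1 √(2/3) s` such that
(H1) no site is fixed, (H2) no site is moved to a contact, (H3) no site is moved to a contact of a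
contact (`∀ q m ∈ B, dist q m = 1 → dist m (σ q) ≠ 1`),
some power `σ^[n]` is a non-zero translation `τ` with `B ± τ ⊆ B`.

Findings of the standing disprover (cycle 3), all kernel-checked below:

* `free_of_noTwoStep`, `noContact_of_noTwoStep` — **(H1) and (H2) are implied by (H3)** (every
  site has a contact; a touching pair has four common touching neighbours,
  `ncard_commonTouching_eq_four`), so the stub is equivalent to its (H3)-only form: a prover may
  drop (H1), (H2), and the torsion lemma it needs is exactly "a finite-order symmetry moves some
  site by graph distance `≤ 2`".
* `stub_powerTranslation_false_without_twoStep` — **(H3) is load-bearing**: with (H3) dropped the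
  stub is FALSE.  Witness: the central inversion `σ x = p₂ − x` of the FCC stacking
  (`s = constHagg`) through the centre `p₂/2` of an octahedral hole (`p₂ = barlowPos 1 (−1) (−1)`,
  `‖p₂‖ = √2`): it is a contact automorphism (`σ (barlowPos k i j) = barlowPos (1−k) (−1−i) (−1−j)`),
  fixes no site (`2k ≠ 1`), moves no site to a contact (parity: the in-layer offset `(2i+1, 2j+1)`
  is odd–odd, every `threeOffsets` vector has a zero entry), but is an involution, so its powers are
  `id` and `σ`, neither of which is a non-zero translation on `B`.  (It moves the six vertices of
  the octahedron to their antipodes, graph distance `2` — excluded by (H3) only.)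

No Theses declaration is asserted positively; `IsContactAut` is the lead's reviewed definition
(`PalmUnimodularRigidityShellsToBarlowChartDefs`).
-/

noncomputable section

namespace Summit.AtomisticToContinuum.Crystallization.Theorems.ShellsToBarlowChartNegative

open Literature.Geometry.DiscreteGeometry Literature.MathematicalPhysics.StatisticalMechanics
open Summit.AtomisticToContinuum.Crystallization.Theorems.PalmUnimodularRigidityShellsToBarlowChart

/-- Euclidean `3`-space. -/
local notation "E3" => EuclideanSpace ℝ (Fin 3)

/-! ## (H3) implies (H1) and (H2) -/

/-- The two-step hypothesis (H3) of `stub_powerTranslation`: no site is moved to a contact of one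
of its contacts. [folklore] -/
def NoTwoStep (s : ℤ → ℤ) (σ : E3 → E3) : Prop :=
  ∀ q ∈ barlowStacking 1 (Real.sqrt (2 / 3)) s, ∀ m ∈ barlowStacking 1 (Real.sqrt (2 / 3)) s,
    dist q m = 1 → dist m (σ q) ≠ 1

/-- **(H3) ⇒ (H1)**: under the two-step hypothesis no site is fixed (a fixed site is a contact of
each of its contacts). [folklore] -/
theorem free_of_noTwoStep {s : ℤ → ℤ} (hs : IsHaggSeq s) {σ : E3 → E3} (h3 : NoTwoStep s σ) :
    ∀ q ∈ barlowStacking 1 (Real.sqrt (2 / 3)) s, σ q ≠ q := by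
  rintro q ⟨k, i, j, rfl⟩ e
  have hm : dist (barlowPos 1 (Real.sqrt (2 / 3)) s k i j)
      (barlowPos 1 (Real.sqrt (2 / 3)) s k (i - 1) j) = 1 := by
    rw [dist_barlowPos_eq_iff hs one_pos (show Real.sqrt (2 / 3) ^ 2 = 2 / 3 * (1 : ℝ) ^ 2 by rw [Real.sq_sqrt (by norm_num)]; norm_num)]
    exact Or.inl ⟨rfl, by simp [sixOffsets]⟩
  have h := h3 _ (barlowPos_mem k i j) _ (barlowPos_mem k (i - 1) j) hm
  rw [e, dist_comm] at h
  exact h hm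

/-- **(H3) ⇒ (H2)**: under the two-step hypothesis no site is moved to a contact (a touching pair
of the ideal stacking has four common touching neighbours, `ncard_commonTouching_eq_four`).
Only `σ(B) ⊆ B` is used. [folklore] -/
theorem noContact_of_noTwoStep {s : ℤ → ℤ} (hs : IsHaggSeq s) {σ : E3 → E3}
    (hσ : Set.MapsTo σ (barlowStacking 1 (Real.sqrt (2 / 3)) s) (barlowStacking 1 (Real.sqrt (2 / 3)) s))
    (h3 : NoTwoStep s σ) :
    ∀ q ∈ barlowStacking 1 (Real.sqrt (2 / 3)) s, dist q (σ q) ≠ 1 := by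
  intro q hq h1
  have h4 := ncard_commonTouching_eq_four hs one_pos (show Real.sqrt (2 / 3) ^ 2 = 2 / 3 * (1 : ℝ) ^ 2 by rw [Real.sq_sqrt (by norm_num)]; norm_num) hq (hσ hq) h1
  obtain ⟨m, hmB, hqm, hσm⟩ :
      {w | w ∈ barlowStacking 1 (Real.sqrt (2 / 3)) s ∧ dist q w = 1 ∧ dist (σ q) w = 1}.Nonempty :=
    Set.nonempty_of_ncard_ne_zero (by rw [h4]; norm_num)
  exact h3 q hq m hmB hqm (by rw [dist_comm]; exact hσm)

/-- Hence the hypotheses of `stub_powerTranslation` collapse to (H3): a contact automorphism with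
the two-step property is site-free and contact-free. [folklore] -/
theorem powerTranslation_hyps_of_noTwoStep {s : ℤ → ℤ} (hs : IsHaggSeq s) {σ : E3 → E3}
    (hσ : IsContactAut s σ) (h3 : NoTwoStep s σ) :
    (∀ q ∈ barlowStacking 1 (Real.sqrt (2 / 3)) s, σ q ≠ q) ∧
      (∀ q ∈ barlowStacking 1 (Real.sqrt (2 / 3)) s, dist q (σ q) ≠ 1) :=
  ⟨free_of_noTwoStep hs h3, noContact_of_noTwoStep hs hσ.1.mapsTo h3⟩

/-! ## (H3) is load-bearing: the octahedral inversion of the FCC stacking -/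

/-- `stub_powerTranslation` with the two-step hypothesis (H3) dropped ((H1), (H2) kept). -/
def PowerTranslationWithoutTwoStep : Prop :=
  ∀ (s : ℤ → ℤ) (σ : E3 → E3), IsHaggSeq s → IsContactAut s σ →
    (∀ q ∈ barlowStacking 1 (Real.sqrt (2 / 3)) s, σ q ≠ q) →
    (∀ q ∈ barlowStacking 1 (Real.sqrt (2 / 3)) s, dist q (σ q) ≠ 1) →
      ∃ τ : E3, τ ≠ 0 ∧
        (∀ q ∈ barlowStacking 1 (Real.sqrt (2 / 3)) s,
          q + τ ∈ barlowStacking 1 (Real.sqrt (2 / 3)) s ∧ q - τ ∈ barlowStacking 1 (Real.sqrt (2 / 3)) s) ∧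
        ∃ n : ℕ, ∀ q ∈ barlowStacking 1 (Real.sqrt (2 / 3)) s, σ^[n] q = q + τ

/-- The FCC site `p₂ = barlowPos 1 (−1) (−1)` at distance `√2` from the origin site; `p₂ / 2` is
the centre of an octahedral hole. [folklore] -/
def octTop : E3 := barlowPos 1 (Real.sqrt (2 / 3)) constHagg 1 (-1) (-1)

/-- The central inversion through the octahedral hole centre `p₂ / 2`. [folklore] -/
def octInv (x : E3) : E3 := octTop - x

/-- `octInv` is an involution. [folklore] -/
theorem octInv_involutive : Function.Involutive octInv := fun x => sub_sub_cancel _ x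

/-- `octInv` is an isometry. [folklore] -/
theorem dist_octInv (x y : E3) : dist (octInv x) (octInv y) = dist x y := by
  rw [octInv, octInv, dist_eq_norm, sub_sub_sub_cancel_left, ← dist_eq_norm, dist_comm]

/-- **The inversion in stacking coordinates**: `p₂ − barlowPos k i j = barlowPos (1−k) (−1−i) (−1−j)`
(the FCC stacking is a lattice: `haggLabel constHagg k = k`). [folklore] -/
theorem octInv_barlowPos (k i j : ℤ) :
    octInv (barlowPos 1 (Real.sqrt (2 / 3)) constHagg k i j) =
      barlowPos 1 (Real.sqrt (2 / 3)) constHagg (1 - k) (-1 - i) (-1 - j) := by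
  ext l
  fin_cases l <;> simp [octInv, octTop] <;> ring

/-- `octInv` maps the FCC stacking into itself. [folklore] -/
theorem octInv_mem {x : E3} (hx : x ∈ barlowStacking 1 (Real.sqrt (2 / 3)) constHagg) :
    octInv x ∈ barlowStacking 1 (Real.sqrt (2 / 3)) constHagg := by
  obtain ⟨k, i, j, rfl⟩ := hx
  rw [octInv_barlowPos]
  exact barlowPos_mem _ _ _

/-- `octInv` is a contact automorphism of the FCC stacking. [folklore] -/
theorem isContactAut_octInv : IsContactAut constHagg octInv := by
  refine ⟨⟨fun x hx => octInv_mem hx, fun _ _ _ _ hxy => octInv_involutive.injective hxy,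
    fun x hx => ⟨octInv x, octInv_mem hx, octInv_involutive x⟩⟩, fun q _ q' _ => ?_⟩
  rw [dist_octInv]

/-- `octInv` fixes no site (`2k = 1` has no integer solution). [folklore] -/
theorem octInv_ne_self {x : E3} (hx : x ∈ barlowStacking 1 (Real.sqrt (2 / 3)) constHagg) :
    octInv x ≠ x := by
  obtain ⟨k, i, j, rfl⟩ := hx
  rw [octInv_barlowPos]
  intro e
  have h1 := le_dist_barlowPos_of_ideal isHaggSeq_const one_pos (show Real.sqrt (2 / 3) ^ 2 = 2 / 3 * (1 : ℝ) ^ 2 by rw [Real.sq_sqrt (by norm_num)]; norm_num)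
    (s := constHagg) (k := 1 - k) (i := -1 - i) (j := -1 - j) (k' := k) (i' := i) (j' := j)
    (by simp only [ne_eq, Prod.mk.injEq]; omega)
  rw [e, dist_self] at h1
  norm_num at h1

/-- `octInv` moves no site to a contact: the in-layer offset between a site and its image is
`(2i+1, 2j+1)`, odd in both entries, while every adjacent-layer touching offset has a zero entry.
[folklore] -/
theorem dist_octInv_ne_one {x : E3} (hx : x ∈ barlowStacking 1 (Real.sqrt (2 / 3)) constHagg) :
    dist x (octInv x) ≠ 1 := by
  obtain ⟨k, i, j, rfl⟩ := hx
  rw [octInv_barlowPos]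
  intro h1
  rw [dist_barlowPos_eq_iff isHaggSeq_const one_pos (show Real.sqrt (2 / 3) ^ 2 = 2 / 3 * (1 : ℝ) ^ 2 by rw [Real.sq_sqrt (by norm_num)]; norm_num)] at h1
  rcases h1 with ⟨hk, -⟩ | ⟨hk, hm⟩ | ⟨hk, hm⟩
  · omega
  · have hk0 : k = 0 := by omega
    subst hk0
    simp [threeOffsets, constHagg] at hm
    omega
  · have hk1 : k = 1 := by omega
    subst hk1
    simp [threeOffsets, constHagg] at hm
    omega

/-- The heights of the two reference sites. [folklore] -/
theorem octTop_apply_two : octTop 2 = Real.sqrt (2 / 3) := by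
  simp [octTop]

/-- **(H3) is load-bearing: `stub_powerTranslation` without the two-step hypothesis is false.**
The octahedral inversion `octInv` of the FCC stacking satisfies (H1), (H2) and is a contact
automorphism, but no power of it is a non-zero translation: its powers are `id` (then `τ = 0`)
and `octInv` itself (then the heights of the origin site and of `p₂` would give `τ₃ = √(2/3)` and
`τ₃ = −√(2/3)`). [folklore] -/
theorem stub_powerTranslation_false_without_twoStep : ¬ PowerTranslationWithoutTwoStep := by
  intro h
  obtain ⟨τ, hτ, -, n, hn⟩ := h constHagg octInv isHaggSeq_const isContactAut_octInv
    (fun x hx => octInv_ne_self hx) (fun x hx => dist_octInv_ne_one hx)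
  have h0 := hn _ (barlowPos_mem 0 0 0)
  have h1 := hn _ (barlowPos_mem 1 (-1) (-1))
  rcases Nat.even_or_odd n with he | ho
  · rw [octInv_involutive.iterate_even he, id_eq] at h0
    exact hτ (by simpa using h0.symm)
  · rw [octInv_involutive.iterate_odd ho] at h0 h1
    have e0 := congrArg (fun z : E3 => z 2) h0
    have e1 := congrArg (fun z : E3 => z 2) h1
    simp only [octInv, PiLp.sub_apply, PiLp.add_apply, octTop_apply_two, barlowPos_apply_two,
      Int.cast_zero, zero_mul, Int.cast_one, one_mul] at e0 e1
    have hpos : 0 < Real.sqrt (2 / 3) := Real.sqrt_pos.2 (by norm_num)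
    linarith

end Summit.AtomisticToContinuum.Crystallization.Theorems.ShellsToBarlowChartNegative

end
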